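import Summits.HubbardSuperconductivity.HubbardLadder.Bounds.ThermalMottStiffnessCeiling
import Literature.MathematicalPhysics.QuantumLattice.HubbardCanonicalSusceptibilityBounds
import HarnessLib


/-!
# Hubbard ladder — Bounds: the CANONICAL thermal Mott-window charge-susceptibility and staggered
# charge (CDW) ceilings of the half-filled repulsive torus at `T > 0` — UNCONDITIONAL
# (bounds.tex Cor. 11.1(iii)–(iv), typed AND proved; no named fact is used)

HONEST FRAMING (cell pub-hubbard): ladder R1–R4 with certified numbers; no claim on H/H₀. These
are bounds for a MODEL CLASS — the repulsive Hubbard torus `hubbardTorusTT' L 1 0 U`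
(`= hamiltonian (fermionTorusGraph 2 L) 1 U`; `t = 1`, `t' = 0`, `U > 0`, torus `(ℤ/Lℤ)²`, `L ≥ 4`
even) in the CANONICAL Gibbs state `⟨·⟩_{β,p}` of its compression `H|_p` to the half-filled
`(L², S^z = 0)` coordinate sector `p` (`|s| = L²`, `2 · #{i ∈ s : spin i = 0} = L²`; the sector and
the state of `ThermalMottStiffnessCeiling`, LEAN FILING REQUEST #158) at `β > 0`; no materials
claim. Companion text: `pub-hubbard/paper/bounds.tex` Thm 11, Cor. 11.1, Remark 11; tables
`pub-hubbard/pub-hubbard-bounds/BOUNDS.md` (rows T9, T9♮, T9𝄪) and `EXTREMISERS.md` §5o–§5s.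

This is the canonical twin of `ThermalMottCDWCeiling` (REQUEST #163, grand-canonical, conditional on
the cited Kubo–Kishi Gaussian domination). Here NOTHING is assumed: the half-filled-sector Gaussian
domination is the PROVED tree theorem `hubbard_repulsive_halfFilledSector_blockGaussianDomination`
(`Literature/…/HubbardCanonicalSusceptibilityBounds`: Lieb's spin-reflection positivity in the
sector `(k,k)` — `hubbard_attractive_sectorGaussianDomination` — transported to the repulsive
half-filled sectors `(k, |Λ|-k)` by the Shiba transformation, which maps sectors to sectors).

## What is proved (no `sorry`, no new axioms, no named-fact hypothesis)

For `L ≥ 4` even (`Even L`, `3 ≤ L`), `U > 0`, `β > 0`, `p` ANY decidable presentation of the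
`(L²/2 ↑, L²/2 ↓)` sector, `F_Q = Σ_x (-1)^x (n_x - 1)` the staggered charge field, `H = H(1,U)`:
* `duhamel_staggeredCharge_toBlock_le` — **Cor. 11.1(iii), the canonical staggered charge
  susceptibility ceiling**: `(F_Q|_p, F_Q|_p)_{β,H|_p} ≤ L²/(βU)`, i.e. `χ_cc(Q) := β (F_Q,F_Q)/L²
  ≤ 1/U` per site (Kubo–Kishi (5) in the sector).
* `re_gibbsState_staggeredCharge_sq_toBlock_le_mott` — **Cor. 11.1(iv), the canonical thermal Mott
  CDW ceiling** (`0 ≤ U₁ < U`, `Δ ≠ 0`): `⟨(F_Q|_p)²⟩_{β,p} ≤ L²/(βU) + ½ √((L²/U) · 4 k_p)` with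
  `k_p := L² (U₁ sdwClosed U Δ - U lmClosed U₁)/(U - U₁) + (U₁/(U - U₁)) (log N_p)/β` the canonical
  Mott-window kinetic ceiling `ThermalMottKineticCeilingSharp` (`N_p = dim p = binom(L², L²/2)²`,
  `log N_p ≤ L² log 4`). Proof: the sector Falk–Bruch inequality
  `hubbard_repulsive_halfFilledSector_falkBruch_le` + the exact BLOCK f-sum identity
  `chargeDensityField_doubleComm_toBlock_eq` (`[F|_p,[H|_p,F|_p]] = (t T((a_x-a_y)²))|_p`, here
  `(a_x - a_y)² = 4` on every bond, and `T(1)|_p = -H(1,0)|_p`) + REQUEST #158's kinetic ceiling. The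
  f-sum constant is thus `4⟨-T⟩_{β,p} ≤ 4 k_p` in place of the operator-norm / degree bound `16 L²`
  of KK90 Remark 3 — the sharpening.
* Nodes `ThermalMottChargeSusceptibilityCeilingCanonical`, `ThermalMottCDWCeilingCanonical`
  (`@[conjecture] def`, each proved by `…_holds`) and the instance `ThermalMottCDWCeilingCanonicalU20`
  (`U = 20`, `U₁ = Δ = 10`): per site `S^{cc}(Q)_p ≤ T/20 + √((1.228 + T log 4)/20)` (`= 0.248` at
  `T → 0` against `√(4/20) = 0.447` from the degree bound), every even `L ≥ 4`, every `T > 0`.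

Honest numbers: informative only in the Mott window `U ≳ 14 t`, `T ≲ t`; finite volume, fixed
particle numbers; the thermodynamic limit and `T = 0` are not addressed here.
References (keys of `lean/references.bib`): KuboKishi1990 Thm 2, eqs. (5)–(6), Remark 3;
LiebPRL1989 Thm 2; DLS1978 Lemma 4.1; LangerMattis1971 eqs. (3)–(5); HazraVermaRanderia2019 §III.
-/


noncomputable section

namespace Summit.HubbardSuperconductivity.HubbardLadder.Bounds

open Matrix Finset Real
open Literature.MathematicalPhysics.QuantumLattice
open Literature.MathematicalPhysics.QuantumFieldTheory
open Literature.Probability.LatticeModels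
open scoped ComplexOrder ComplexConjugate

/-- `T(w) = c · T(1)` when `w = c` on every bond (`T(w)` only sees the bond values of `w`). -/
theorem hoppingForm_eq_smul_one_of_adj {Λ : Type*} [LinearOrder Λ] [Fintype Λ] (G : SimpleGraph Λ)
    [DecidableRel G.Adj] {w : Λ → Λ → ℝ} {c : ℝ} (hw : ∀ x y, G.Adj x y → w x y = c) :
    hoppingForm G w = (c : ℂ) • hoppingForm G fun _ _ => 1 := by
  rw [hoppingForm_eq, hoppingForm_eq, Finset.smul_sum]
  refine Finset.sum_congr rfl fun x _ => ?_
  rw [Finset.smul_sum]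
  refine Finset.sum_congr rfl fun y _ => ?_
  rw [Finset.smul_sum]
  refine Finset.sum_congr rfl fun σ _ => ?_
  by_cases hxy : G.Adj x y
  · rw [if_pos hxy, if_pos hxy, hw x y hxy, smul_smul, Complex.ofReal_one, mul_one]
  · rw [if_neg hxy, if_neg hxy, smul_zero]

section Torus

variable {L : ℕ} [NeZero L]

/-- The torus graph `(ℤ/Lℤ)²` with nearest-neighbour bonds. -/
local notation "Gᴸ" => fermionTorusGraph 2 L
/-- The staggered charge field `F_Q = Σ_x (-1)^x (n_x - 1)`. -/
local notation "F_Q" =>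
  chargeDensityField fun x => ((torusStagger (d := 2) (L := L) x : ℤ) : ℝ)

omit [NeZero L] in
/-- Every coordinate sector of the `L × L` torus has `log dim ≤ L² log 4` (`dim ≤ |Finset (Orb Λ)|
= 4^{L²}`). -/
theorem log_card_sector_le_log_four (p : Finset (Orb (FermionTorus 2 L)) → Prop) [DecidablePred p]
    [Nonempty {s // p s}] :
    Real.log (Fintype.card {s // p s}) ≤ (L : ℝ) ^ 2 * Real.log 4 := by
  have h1 : Fintype.card {s // p s} ≤ Fintype.card (Finset (Orb (FermionTorus 2 L))) :=
    Fintype.card_subtype_le p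
  have h2 : Fintype.card (Finset (Orb (FermionTorus 2 L))) = 4 ^ (L ^ 2) := by
    rw [Fintype.card_finset, card_orb, show Fintype.card (FermionTorus 2 L) = L ^ 2 by
      simp [FermionTorus], pow_mul]
    norm_num
  have h3 : Fintype.card {s // p s} ≤ 4 ^ (L ^ 2) := h2 ▸ h1
  have h0 : (0 : ℝ) < Fintype.card {s // p s} := Nat.cast_pos.2 Fintype.card_pos
  calc Real.log (Fintype.card {s // p s}) ≤ Real.log ((4 : ℝ) ^ (L ^ 2)) :=
        Real.log_le_log h0 (by exact_mod_cast h3)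
    _ = (L : ℝ) ^ 2 * Real.log 4 := by rw [Real.log_pow]; push_cast; ring

omit [NeZero L] in
/-- `T(1) = -H(1,0)` on the torus (`t' = 0`, `U = 0`: the pure hopping Hamiltonian). -/
theorem hoppingForm_one_eq_neg_hubbardTorusTT' :
    hoppingForm Gᴸ (fun _ _ => (1 : ℝ)) = -hubbardTorusTT' L 1 0 0 := by
  have h1 : hubbardTorusTT' L 1 0 0 = hamiltonianWith Gᴸ 1 0 0 := by
    rw [hubbardTorusTT'_zero, hamiltonianWith_zero]; rfl
  rw [h1, hamiltonianWith_eq_hoppingForm, densityTerms_eq]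
  simp

omit [NeZero L] in
/-- `H(1,U)` on the torus at `t' = 0` is the graph Hamiltonian `hamiltonian (fermionTorusGraph 2 L) 1 U`. -/
theorem hubbardTorusTT'_one_zero_eq (U : ℝ) : hubbardTorusTT' L 1 0 U = hamiltonian Gᴸ 1 U := by
  rw [hubbardTorusTT'_zero]; rfl

omit [NeZero L] in
/-- Monotonicity of the Falk–Bruch right side in the double-commutator slot. -/
theorem fbRhs_mono_doubleComm {b β c c' : ℝ} (hb : 0 ≤ b) (hc : c ≤ c') :
    b / β + 1 / 2 * Real.sqrt (b * c) ≤ b / β + 1 / 2 * Real.sqrt (b * c') := by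
  have : Real.sqrt (b * c) ≤ Real.sqrt (b * c') :=
    Real.sqrt_le_sqrt (mul_le_mul_of_nonneg_left hc hb)
  linarith

/-! ### Cor. 11.1(iii): the canonical staggered charge susceptibility ceiling -/

omit [NeZero L] in
/-- **Cor. 11.1(iii): Kubo–Kishi (5) in a half-filled sector of the torus, UNCONDITIONAL**
(`L` even, `U > 0`, `β > 0`, `p` any presentation of a sector `(k ↑, L²-k ↓)`, non-empty):
`(F_Q|_p, F_Q|_p)_{β, H(1,U)|_p} ≤ L²/(βU)` (every `S^z`; the staggered field has `Σ_x a_x² = L²`).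
-/
theorem duhamel_staggeredCharge_toBlock_le (hLe : Even L) {U β : ℝ} (hU : 0 < U) (hβ : 0 < β)
    {k l : ℕ} (hkl : k + l = L ^ 2) (p : Finset (Orb (FermionTorus 2 L)) → Prop) [DecidablePred p]
    [Nonempty {s // p s}] (hp : ∀ s, p s ↔ (upPart s).card = k ∧ (downPart s).card = l) :
    (duhamel β ((hubbardTorusTT' L 1 0 U).toBlock p p) ((F_Q).toBlock p p) ((F_Q).toBlock p p)).re ≤
      (L : ℝ) ^ 2 / U / β := by
  have hcard : Fintype.card (FermionTorus 2 L) = L ^ 2 := by simp [FermionTorus]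
  have hkl' : k + l = Fintype.card (FermionTorus 2 L) := by rw [hcard]; exact hkl
  have hε : ∀ x y : FermionTorus 2 L, (Gᴸ).Adj x y →
      torusStagger (d := 2) (L := L) x = -torusStagger y :=
    fun _ _ h => torusStagger_eq_neg_of_adj_holds hLe h
  have hsq : ∀ x : FermionTorus 2 L, (((torusStagger (d := 2) (L := L) x : ℤ) : ℝ)) ^ 2 = 1 := by
    intro x
    rcases Int.units_eq_one_or (torusStagger (d := 2) (L := L) x) with h1 | h1 <;> simp [h1]
  have hB : (∑ x : FermionTorus 2 L, (((torusStagger (d := 2) (L := L) x : ℤ) : ℝ)) ^ 2) =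
      (L : ℝ) ^ 2 := by
    simp [hsq, hcard]
  have h := hubbard_repulsive_halfFilledSector_duhamel_le Gᴸ _ hε (t := 1) hU hβ
    (fun x => ((torusStagger (d := 2) (L := L) x : ℤ) : ℝ)) hkl' p hp
  rw [hB] at h
  rw [hubbardTorusTT'_one_zero_eq]
  -- (`convert`: the sector lemma carries the generic `DecidableEq` instance on configurations)
  convert h using 6

/-- Node form of Cor. 11.1(iii) in the half-filled `(L², S^z = 0)` sector of REQUEST #158: per site,
the static staggered charge susceptibility `χ_cc(Q) := β (F_Q|_p, F_Q|_p)_{β,p}/L² ≤ 1/U` for every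
even `L ≥ 2`, `U > 0`, `T > 0`. kind: support (PROVED, unconditional). Why it might fail: it cannot.
Sources: KuboKishi1990 Thm 2, eq. (5); LiebPRL1989 Thm 2; DLS1978 Lemma 4.1; this cell (bounds.tex
Thm 11, Cor. 11.1(iii)). -/
@[conjecture] def ThermalMottChargeSusceptibilityCeilingCanonical : Prop :=
  ∀ (L : ℕ) [NeZero L], Even L → ∀ (U β : ℝ), 0 < U → 0 < β →
    let p : Finset (Orb (FermionTorus 2 L)) → Prop := fun s =>
      s.card = L ^ 2 ∧ 2 * (s.filter fun i => (ofLex i).2 = 0).card = L ^ 2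
    β * (duhamel β ((hubbardTorusTT' L 1 0 U).toBlock p p)
        ((chargeDensityField fun x => ((torusStagger (d := 2) (L := L) x : ℤ) : ℝ)).toBlock p p)
        ((chargeDensityField fun x => ((torusStagger (d := 2) (L := L) x : ℤ) : ℝ)).toBlock p p)).re
      ≤ (L : ℝ) ^ 2 / U

omit [NeZero L] in
/-- The half-filled `(L², S^z = 0)` coordinate sector IS the `(L²/2 ↑, L²/2 ↓)` sector (even `L`). -/
theorem halfFilledSector_iff (hLe : Even L) (s : Finset (Orb (FermionTorus 2 L))) :
    (s.card = L ^ 2 ∧ 2 * (s.filter fun i => (ofLex i).2 = 0).card = L ^ 2) ↔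
      (upPart s).card = L ^ 2 / 2 ∧ (downPart s).card = L ^ 2 / 2 := by
  have hL2e : 2 * (L ^ 2 / 2) = L ^ 2 :=
    Nat.two_mul_div_two_of_even (Nat.even_pow.2 ⟨hLe, two_ne_zero⟩)
  refine ⟨fun h => ?_, fun h => halfFilledSector_of_card_upPart_downPart hLe s h⟩
  have hu : (upPart s).card = L ^ 2 / 2 := by
    have h2 := h.2
    rw [card_filter_spin_zero_eq_card_upPart] at h2
    omega
  refine ⟨hu, ?_⟩
  have hc := card_eq_upPart_add_downPart s
  rw [h.1, hu] at hc
  omega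

/-- **`ThermalMottChargeSusceptibilityCeilingCanonical` holds.** -/
theorem thermalMottChargeSusceptibilityCeilingCanonical_holds :
    ThermalMottChargeSusceptibilityCeilingCanonical := by
  intro L _ hLe U β hU hβ
  dsimp only
  set p : Finset (Orb (FermionTorus 2 L)) → Prop := fun s =>
    s.card = L ^ 2 ∧ 2 * (s.filter fun i => (ofLex i).2 = 0).card = L ^ 2 with hp
  haveI : Nonempty {a // p a} := nonempty_halfFilledSector (L := L) hLe
  have hL2e : 2 * (L ^ 2 / 2) = L ^ 2 :=
    Nat.two_mul_div_two_of_even (Nat.even_pow.2 ⟨hLe, two_ne_zero⟩)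
  have h := duhamel_staggeredCharge_toBlock_le hLe hU hβ (k := L ^ 2 / 2) (l := L ^ 2 / 2)
    (by omega) p (fun s => halfFilledSector_iff hLe s)
  calc β * _ ≤ β * ((L : ℝ) ^ 2 / U / β) := mul_le_mul_of_nonneg_left h hβ.le
    _ = (L : ℝ) ^ 2 / U := by rw [mul_comm]; exact div_mul_cancel₀ _ hβ.ne'

/-! ### Cor. 11.1(iv): the canonical thermal Mott CDW ceiling -/

/-- **Cor. 11.1(iv): the staggered charge structure factor of the half-filled repulsive torus in the
Mott window, canonical `(L², S^z = 0)` ensemble, UNCONDITIONAL** (`L ≥ 4` even, `0 ≤ U₁ < U`,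
`Δ ≠ 0`, `β > 0`, `p` any presentation of the `(L²/2 ↑, L²/2 ↓)` sector, `N_p = dim p`): with
`k_p := L² (U₁ sdwClosed U Δ - U lmClosed U₁)/(U - U₁) + (U₁/(U - U₁)) (log N_p)/β`,
`⟨(F_Q|_p)²⟩_{β,p} ≤ L²/(βU) + ½ √((L²/U) · 4 k_p)`. [Kubo–Kishi's Thm 2 + Remark 3 in the sector,
the degree bound of the double commutator replaced by the block f-sum identity and the canonical
Mott-window kinetic ceiling.] -/
theorem re_gibbsState_staggeredCharge_sq_toBlock_le_mott (hLe : Even L) (hL : 3 ≤ L)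
    {U U₁ Δ β : ℝ} (hU₁ : 0 ≤ U₁) (hU : U₁ < U) (hΔ : Δ ≠ 0) (hβ : 0 < β)
    (p : Finset (Orb (FermionTorus 2 L)) → Prop) [DecidablePred p] [Nonempty {s // p s}]
    (hp : ∀ s, p s ↔ (upPart s).card = L ^ 2 / 2 ∧ (downPart s).card = L ^ 2 / 2) :
    (gibbsState β ((hubbardTorusTT' L 1 0 U).toBlock p p) ((F_Q).toBlock p p * (F_Q).toBlock p p)).re ≤
      (L : ℝ) ^ 2 / U / β +
        1 / 2 * Real.sqrt ((L : ℝ) ^ 2 / U *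
          (4 * ((L : ℝ) ^ 2 * ((U₁ * sdwClosed U Δ - U * lmClosed U₁) / (U - U₁)) +
            U₁ / (U - U₁) * (Real.log (Fintype.card {s // p s}) / β)))) := by
  have hU0 : 0 < U := lt_of_le_of_lt hU₁ hU
  have hcard : Fintype.card (FermionTorus 2 L) = L ^ 2 := by simp [FermionTorus]
  have hL2e : 2 * (L ^ 2 / 2) = L ^ 2 :=
    Nat.two_mul_div_two_of_even (Nat.even_pow.2 ⟨hLe, two_ne_zero⟩)
  have hkl : L ^ 2 / 2 + L ^ 2 / 2 = Fintype.card (FermionTorus 2 L) := by rw [hcard]; omega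
  have hε : ∀ x y : FermionTorus 2 L, (Gᴸ).Adj x y →
      torusStagger (d := 2) (L := L) x = -torusStagger y :=
    fun _ _ h => torusStagger_eq_neg_of_adj_holds hLe h
  -- Kubo–Kishi's Falk–Bruch form in the sector, one field
  have h := hubbard_repulsive_halfFilledSector_falkBruch_le Gᴸ _ hε (t := 1) hU0 hβ hkl p hp
    (ι := Unit) (fun _ => fun x => ((torusStagger (d := 2) (L := L) x : ℤ) : ℝ))
  simp only [Finset.univ_unique, Finset.sum_singleton] at h
  have hsq : ∀ x : FermionTorus 2 L, (((torusStagger (d := 2) (L := L) x : ℤ) : ℝ)) ^ 2 = 1 := by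
    intro x
    rcases Int.units_eq_one_or (torusStagger (d := 2) (L := L) x) with h1 | h1 <;> simp [h1]
  have hB : (∑ x : FermionTorus 2 L, (((torusStagger (d := 2) (L := L) x : ℤ) : ℝ)) ^ 2) =
      (L : ℝ) ^ 2 := by
    simp [hsq, hcard]
  rw [hB] at h
  -- the block f-sum identity: the double commutator is `(4 T(1))|_p = -4 H(1,0)|_p`
  have hgrad : ∀ x y : FermionTorus 2 L, (Gᴸ).Adj x y →
      (((torusStagger (d := 2) (L := L) x : ℤ) : ℝ) - ((torusStagger (d := 2) (L := L) y : ℤ) : ℝ)) ^ 2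
        = 4 := by
    intro x y hxy
    have e : ((torusStagger (d := 2) (L := L) y : ℤ) : ℝ) =
        -((torusStagger (d := 2) (L := L) x : ℤ) : ℝ) := by
      rw [hε x y hxy, Units.val_neg, Int.cast_neg, neg_neg]
    rw [e, show ∀ r : ℝ, (r - -r) ^ 2 = 4 * r ^ 2 from fun r => by ring, hsq x, mul_one]
  have hdc : (F_Q).toBlock p p *
        ((hamiltonian Gᴸ 1 U).toBlock p p * (F_Q).toBlock p p -
          (F_Q).toBlock p p * (hamiltonian Gᴸ 1 U).toBlock p p) -
      ((hamiltonian Gᴸ 1 U).toBlock p p * (F_Q).toBlock p p -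
          (F_Q).toBlock p p * (hamiltonian Gᴸ 1 U).toBlock p p) * (F_Q).toBlock p p =
      -((((4 : ℝ) : ℂ)) • (hubbardTorusTT' L 1 0 0).toBlock p p) := by
    rw [chargeDensityField_doubleComm_toBlock_eq Gᴸ _ 1 U p hp, hoppingForm_eq_smul_one_of_adj Gᴸ hgrad,
      hoppingForm_one_eq_neg_hubbardTorusTT', Complex.ofReal_one, one_smul, smul_neg]
    rfl
  have hre : (gibbsState β ((hamiltonian Gᴸ 1 U).toBlock p p) ((F_Q).toBlock p p *
        ((hamiltonian Gᴸ 1 U).toBlock p p * (F_Q).toBlock p p -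
          (F_Q).toBlock p p * (hamiltonian Gᴸ 1 U).toBlock p p) -
      ((hamiltonian Gᴸ 1 U).toBlock p p * (F_Q).toBlock p p -
          (F_Q).toBlock p p * (hamiltonian Gᴸ 1 U).toBlock p p) * (F_Q).toBlock p p)).re =
      4 * (-(gibbsState β ((hubbardTorusTT' L 1 0 U).toBlock p p)
        ((hubbardTorusTT' L 1 0 0).toBlock p p)).re) := by
    rw [hdc, map_neg, map_smul, Complex.neg_re, smul_eq_mul, Complex.re_ofReal_mul,
      hubbardTorusTT'_one_zero_eq U]
    ring
  -- re-elaborate `h` with this file's instances (`convert` closes the `DecidableEq` mismatch)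
  have h' : (gibbsState β ((hamiltonian Gᴸ 1 U).toBlock p p) ((F_Q).toBlock p p * (F_Q).toBlock p p)).re ≤
      (L : ℝ) ^ 2 / U / β +
        1 / 2 * Real.sqrt ((L : ℝ) ^ 2 / U *
          (gibbsState β ((hamiltonian Gᴸ 1 U).toBlock p p) ((F_Q).toBlock p p *
              ((hamiltonian Gᴸ 1 U).toBlock p p * (F_Q).toBlock p p -
                (F_Q).toBlock p p * (hamiltonian Gᴸ 1 U).toBlock p p) -
            ((hamiltonian Gᴸ 1 U).toBlock p p * (F_Q).toBlock p p -
                (F_Q).toBlock p p * (hamiltonian Gᴸ 1 U).toBlock p p) * (F_Q).toBlock p p)).re) := by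
    convert h using 12
  rw [hre] at h'
  rw [hubbardTorusTT'_one_zero_eq U]
  refine h'.trans (fbRhs_mono_doubleComm (div_nonneg (sq_nonneg _) hU0.le) ?_)
  have hpN : ∀ s, p s → s.card = L ^ 2 := fun s hs => by
    rw [card_eq_upPart_add_downPart, ((hp s).1 hs).1, ((hp s).1 hs).2]; omega
  exact mul_le_mul_of_nonneg_left (neg_re_gibbsState_hopping_le_mott_sharp hLe hL hU₁ hU hΔ hβ p
    hpN fun s hs => (hp s).2 hs) (by norm_num)

/-- Node form of Cor. 11.1(iv) (UNCONDITIONAL; the sector and state of `ThermalMottKineticCeilingSharp`).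
Per site, with `N_p = binom(L², L²/2)²` (`log N_p ≤ L² log 4`):
`S^{cc}(Q)_p := ⟨(F_Q|_p)²⟩_{β,p}/L² ≤ T/U + √(κ̃_p/U)`, `κ̃_p = (U₁ sdwClosed U Δ - U lmClosed U₁)/(U - U₁)
+ (U₁/(U - U₁)) T (log N_p)/L²`; at `U₁ = Δ = U/2`: `κ̃_p ≤ κ(U) + T log 4`, `κ(U) = 28/U + O(U⁻³)`
(`κ(20) = 1.2241`). kind: support (PROVED). Why it might fail: it cannot; informative only for
`U ≳ 14 t`, `T ≲ t`. Sources: KuboKishi1990 Thm 2, Remark 3; LiebPRL1989 Thm 2; DLS1978 Lemma 4.1;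
LangerMattis1971 eqs. (3)–(5); HazraVermaRanderia2019 §III; this cell (bounds.tex Thm 7♯, Thm 11,
Cor. 11.1; grand-canonical twin `ThermalMottCDWCeilingKK`). -/
@[conjecture] def ThermalMottCDWCeilingCanonical : Prop :=
  ∀ (L : ℕ) [NeZero L], Even L → 3 ≤ L → ∀ (U U₁ Δ β : ℝ), 0 ≤ U₁ → U₁ < U → Δ ≠ 0 → 0 < β →
    let p : Finset (Orb (FermionTorus 2 L)) → Prop := fun s =>
      s.card = L ^ 2 ∧ 2 * (s.filter fun i => (ofLex i).2 = 0).card = L ^ 2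
    (gibbsState β ((hubbardTorusTT' L 1 0 U).toBlock p p)
        ((chargeDensityField fun x => ((torusStagger (d := 2) (L := L) x : ℤ) : ℝ)).toBlock p p *
          (chargeDensityField fun x => ((torusStagger (d := 2) (L := L) x : ℤ) : ℝ)).toBlock p p)).re ≤
      (L : ℝ) ^ 2 / U / β +
        1 / 2 * Real.sqrt ((L : ℝ) ^ 2 / U *
          (4 * ((L : ℝ) ^ 2 * ((U₁ * sdwClosed U Δ - U * lmClosed U₁) / (U - U₁)) +
            U₁ / (U - U₁) * (Real.log (Fintype.card {s // p s}) / β))))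

/-- **`ThermalMottCDWCeilingCanonical` holds.** -/
theorem thermalMottCDWCeilingCanonical_holds : ThermalMottCDWCeilingCanonical := by
  intro L _ hLe hL U U₁ Δ β hU₁ hU hΔ hβ
  dsimp only
  set p : Finset (Orb (FermionTorus 2 L)) → Prop := fun s =>
    s.card = L ^ 2 ∧ 2 * (s.filter fun i => (ofLex i).2 = 0).card = L ^ 2 with hp
  haveI : Nonempty {a // p a} := nonempty_halfFilledSector (L := L) hLe
  exact re_gibbsState_staggeredCharge_sq_toBlock_le_mott hLe hL hU₁ hU hΔ hβ p
    fun s => halfFilledSector_iff hLe s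

/-! ### The instance `U = 20 t` (`U₁ = Δ = 10`) -/

/-- **`U = 20 t`: `S^{cc}(Q)_p ≤ T/20 + √((1.228 + T log 4)/20)`** per site in the canonical
half-filled `S^z = 0` ensemble of the torus, every even `L ≥ 4`, every `T = 1/β > 0`, UNCONDITIONAL
(exact closed-form constant `1.22404`; `= 0.248` at `T → 0` against `0.447` from the degree bound of
KK90 Remark 3). kind: support (PROVED). -/
@[conjecture] def ThermalMottCDWCeilingCanonicalU20 : Prop :=
  ∀ (L : ℕ) [NeZero L], Even L → 3 ≤ L → ∀ β : ℝ, 0 < β →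
    let p : Finset (Orb (FermionTorus 2 L)) → Prop := fun s =>
      s.card = L ^ 2 ∧ 2 * (s.filter fun i => (ofLex i).2 = 0).card = L ^ 2
    (gibbsState β ((hubbardTorusTT' L 1 0 20).toBlock p p)
        ((chargeDensityField fun x => ((torusStagger (d := 2) (L := L) x : ℤ) : ℝ)).toBlock p p *
          (chargeDensityField fun x => ((torusStagger (d := 2) (L := L) x : ℤ) : ℝ)).toBlock p p)).re ≤
      (L : ℝ) ^ 2 * (1 / (20 * β) + Real.sqrt ((1.228 + Real.log 4 / β) / 20))

/-- **`ThermalMottCDWCeilingCanonicalU20` holds.** -/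
theorem thermalMottCDWCeilingCanonicalU20_holds : ThermalMottCDWCeilingCanonicalU20 := by
  intro L _ hLe hL β hβ
  dsimp only
  set p : Finset (Orb (FermionTorus 2 L)) → Prop := fun s =>
    s.card = L ^ 2 ∧ 2 * (s.filter fun i => (ofLex i).2 = 0).card = L ^ 2 with hp
  haveI : Nonempty {a // p a} := nonempty_halfFilledSector (L := L) hLe
  have h := re_gibbsState_staggeredCharge_sq_toBlock_le_mott hLe hL (U := 20) (U₁ := 10) (Δ := 10)
    (by norm_num) (by norm_num) (by norm_num) hβ p fun s => halfFilledSector_iff hLe s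
  have hA : (0.37138 : ℝ) ≤ 4 / Real.sqrt (16 + 10 ^ 2) :=
    four_div_sqrt_ge' (by norm_num) (Real.sqrt_le_iff.2 ⟨by norm_num, by norm_num⟩ :
      Real.sqrt (16 + 10 ^ 2) ≤ 10.7704) (by norm_num) (by norm_num)
  have hB : Real.sqrt (4 + (10 / 4) ^ 2) ≤ 3.2016 := Real.sqrt_le_iff.2 ⟨by norm_num, by norm_num⟩
  have hX := mott_sharp_numeric_20 hA hB
  -- `X := (10 sdwClosed 20 10 - 20 lmClosed 10)/10 ≤ 4 · 0.307 = 1.228`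
  set X : ℝ := (10 * sdwClosed 20 10 - 20 * lmClosed 10) / (20 - 10) with hXdef
  have hX' : X ≤ 1.228 := by
    have : X / 4 ≤ 0.307 := by
      rw [hXdef, sdwClosed, lmClosed]
      exact hX
    linarith
  have hL2 : (0 : ℝ) < (L : ℝ) ^ 2 := by
    have : (0 : ℝ) < L := by exact_mod_cast (show 0 < L by omega)
    positivity
  -- the entropy term: `log N_p ≤ L² log 4`
  set ℓ : ℝ := Real.log (Fintype.card {s // p s}) with hℓ
  have hℓle : ℓ / β ≤ (L : ℝ) ^ 2 * (Real.log 4 / β) := by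
    rw [mul_div_assoc']
    exact div_le_div_of_nonneg_right (log_card_sector_le_log_four p) hβ.le
  have hℓ0 : 0 ≤ ℓ / β :=
    div_nonneg (Real.log_nonneg (by exact_mod_cast Fintype.card_pos)) hβ.le
  -- rewrite the right side of `h`
  have e1 : (L : ℝ) ^ 2 / 20 * (4 * ((L : ℝ) ^ 2 * X + 10 / (20 - 10) * (ℓ / β))) =
      (2 * (L : ℝ) ^ 2) ^ 2 * ((X + (ℓ / β) / (L : ℝ) ^ 2) / 20) := by
    field_simp
    ring
  have hsqrt : Real.sqrt ((L : ℝ) ^ 2 / 20 * (4 * ((L : ℝ) ^ 2 * X + 10 / (20 - 10) * (ℓ / β)))) ≤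
      2 * (L : ℝ) ^ 2 * Real.sqrt ((1.228 + Real.log 4 / β) / 20) := by
    rw [e1, Real.sqrt_mul (sq_nonneg _), Real.sqrt_sq (by positivity)]
    refine mul_le_mul_of_nonneg_left (Real.sqrt_le_sqrt ?_) (by positivity)
    have hq : ℓ / β / (L : ℝ) ^ 2 ≤ Real.log 4 / β := by
      rw [div_le_iff₀ hL2, mul_comm]
      exact hℓle
    exact div_le_div_of_nonneg_right (add_le_add hX' hq) (by norm_num)
  have e2 : (L : ℝ) ^ 2 * (1 / (20 * β) + Real.sqrt ((1.228 + Real.log 4 / β) / 20)) =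
      (L : ℝ) ^ 2 / 20 / β +
        1 / 2 * (2 * (L : ℝ) ^ 2 * Real.sqrt ((1.228 + Real.log 4 / β) / 20)) := by
    ring
  rw [e2]
  linarith

end Torus

end Summit.HubbardSuperconductivity.HubbardLadder.Bounds

end
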